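import Mathlib
import Literature.NumberTheory.LFunctions.Zhang2022.TypedSection15B
import HarnessLib

/-!
# Zhang (2022) §15 (15.17): the re-indexing `n = dl` that turns the (15.11)-sum into `𝒮₁ⱼ`
# (helper for the (15.17) assembly `eq15_17_chi_of`; theorems only)

Topic `Literature/NumberTheory/LFunctions/Zhang2022` (Landau–Siegel audit tree; verdict-neutral).
Y. Zhang, *Discrete mean estimates and the Landau–Siegel zero*, arXiv:2211.02515v1 (2022)
[Zhang2022LandauSiegel] — an unrefereed manuscript under adjudication; nothing here asserts or denies
its Theorems 1–2. Lane ZHANG-L, WP15, leaf h15_17 (`Typed.Section15B.Eq15_17 c′ bChi` ⇐ (15.11) +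
(15.15), §15 p. 85 tex L4226: "Inserting this into (15.11) and substituting `n = dl` we obtain (15.17)").
The substitution step, EXACT: for any coefficient sequence `b` vanishing from `P` on (both `bLit` and
`bChi` do: `Typed.Section15B.bLit/bChi_eq_zero_of_bigP_le`), any exponent `β` and argument `s`,
`Σ_{d,l ≤ ⌊P⌋} b(dl)χ(l)(dl)⁻¹·λ₁(d)d^{β}𝓜₁(d,l;s) = Σ_{1≤n<⌈P⌉} b(n)n⁻¹ Σ_{n=dl} λ₁(d)d^{β}χ(l)𝓜₁(d,l;s)`
(`sum_Icc_Icc_eq_sum_Ico_divisorsAntidiagonal`), whence with `β = βⱼ`, `s = 1−βⱼ` the right side is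
`Typed.Section15B.calS1 c′ χ b j` (`sum_Icc_Icc_eq_calS1`), and the (15.11)-shaped double sum with the
main term of (15.15) inserted equals `Σⱼ ℛ₁ⱼ·𝒮₁ⱼ` (`sum_Icc_Icc_main1515_eq`). Tools: the tree's
`Typed.Section15B.sum_Icc_filter_sum_Icc_eq_sum_divisors` (the (15.12) re-indexing) and Mathlib's
`Nat.sum_divisorsAntidiagonal`. Theorems only; no claims. WHAT THIS IS NOT: a proof of (15.17).

## References
* Y. Zhang, arXiv:2211.02515v1 (2022), §15 (15.17) p. 85, tex L4226–L4231. [cite: Zhang2022LandauSiegel, §15 (15.17) p. 85]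
-/

noncomputable section

open Complex Real ComplexConjugate
open Literature.NumberTheory.LFunctions.Zhang2022.Typed.Section15A

namespace Literature.NumberTheory.LFunctions.Zhang2022.Typed.Section15B

variable (c' : ℝ) {D : ℕ} (χ : DirichletCharacter ℂ D)

/-- **"substituting `n = dl`"** (§15 p. 85, tex L4226), exact: for `b` vanishing from `P` on,
`Σ_{d,l≤⌊P⌋} b(dl)χ(l)/(dl)·(λ₁(d)d^{β}𝓜₁(d,l;s)) = Σ_{1≤n<⌈P⌉} b(n)/n·Σ_{(d,l): dl=n} λ₁(d)d^{β}χ(l)𝓜₁(d,l;s)`.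
[cite: Zhang2022LandauSiegel, §15 (15.17) p. 85] -/
theorem sum_Icc_Icc_eq_sum_Ico_divisorsAntidiagonal (b : ℕ → ℂ)
    (hb : ∀ n : ℕ, Skeleton.bigP D ≤ n → b n = 0) (β s : ℂ) :
    ∑ d ∈ Finset.Icc 1 ⌊Skeleton.bigP D⌋₊, ∑ l ∈ Finset.Icc 1 ⌊Skeleton.bigP D⌋₊,
        b (d * l) * χ (l : ZMod D) / ((d : ℂ) * l) * (lam1 c' χ d 1 * (d : ℂ) ^ β * calM1 c' χ d l s) =
      ∑ n ∈ Finset.Ico 1 ⌈Skeleton.bigP D⌉₊, b n / (n : ℂ) *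
        ∑ x ∈ n.divisorsAntidiagonal,
          lam1 c' χ x.1 1 * (x.1 : ℂ) ^ β * χ (x.2 : ZMod D) * calM1 c' χ x.1 x.2 s := by
  set N : ℕ := ⌊Skeleton.bigP D⌋₊ with hN
  set F : ℕ → ℕ → ℂ := fun d l =>
    b (d * l) * χ (l : ZMod D) / ((d : ℂ) * l) * (lam1 c' χ d 1 * (d : ℂ) ^ β * calM1 c' χ d l s)
    with hF
  have hP0 : 0 ≤ Skeleton.bigP D := (Real.exp_pos _).le
  -- Step 1: the (15.12)-type re-indexing over `Icc 1 N`
  have hvan : ∀ k m : ℕ, 1 ≤ k → 1 ≤ m → N < k * m → F k m = 0 := by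
    intro k m _ _ hkm
    have hge : Skeleton.bigP D ≤ ((k * m : ℕ) : ℝ) := by
      have h1 : Skeleton.bigP D < (N : ℝ) + 1 := Nat.lt_floor_add_one _
      have h2 : (N : ℝ) + 1 ≤ ((k * m : ℕ) : ℝ) := by exact_mod_cast hkm
      linarith
    simp only [hF, hb (k * m) hge, zero_mul, zero_div]
  have h1 : ∑ d ∈ Finset.Icc 1 N, ∑ l ∈ Finset.Icc 1 N, F d l =
      ∑ n ∈ Finset.Icc 1 N, ∑ k ∈ n.divisors, F k (n / k) := by
    have h := sum_Icc_filter_sum_Icc_eq_sum_divisors (N := N) (fun _ => True) F hvan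
    rw [Finset.filter_true_of_mem (fun _ _ => trivial)] at h
    rw [h]
    exact Finset.sum_congr rfl fun n _ => by rw [Finset.filter_true_of_mem (fun _ _ => trivial)]
  -- Step 2: divisors ↔ divisorsAntidiagonal, and the factorisation `b(n)/n · (…)`
  have h2 : ∀ n ∈ Finset.Icc 1 N, ∑ k ∈ n.divisors, F k (n / k) =
      b n / (n : ℂ) * ∑ x ∈ n.divisorsAntidiagonal,
        lam1 c' χ x.1 1 * (x.1 : ℂ) ^ β * χ (x.2 : ZMod D) * calM1 c' χ x.1 x.2 s := by
    intro n _
    rw [← Nat.sum_divisorsAntidiagonal (f := fun k m => F k m), Finset.mul_sum]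
    refine Finset.sum_congr rfl fun x hx => ?_
    have hxn : x.1 * x.2 = n := (Nat.mem_divisorsAntidiagonal.mp hx).1
    have hcast : ((x.1 : ℂ) * x.2) = (n : ℂ) := by exact_mod_cast hxn
    simp only [hF, hxn]
    rw [hcast]
    ring
  rw [h1, Finset.sum_congr rfl h2]
  -- Step 3: `Icc 1 ⌊P⌋` versus `Ico 1 ⌈P⌉`: the extra indices carry `b(n) = 0`
  symm
  refine Finset.sum_subset ?_ ?_
  · intro n hn
    rw [Finset.mem_Ico] at hn
    rw [Finset.mem_Icc]
    refine ⟨hn.1, ?_⟩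
    have := Nat.ceil_le_floor_add_one (Skeleton.bigP D)
    omega
  · intro n hn hnot
    rw [Finset.mem_Icc] at hn
    rw [Finset.mem_Ico, not_and, not_lt] at hnot
    have hge : Skeleton.bigP D ≤ n := le_trans (Nat.le_ceil _) (by exact_mod_cast hnot hn.1)
    rw [hb n hge, zero_div, zero_mul]

/-- **The double sum of (15.11) with (15.15)'s `j`-term inserted IS `𝒮₁ⱼ`** (§15 p. 85, tex L4226–L4231):
`Σ_{d,l≤⌊P⌋} b(dl)χ(l)/(dl)·λ₁(d)d^{βⱼ}𝓜₁(d,l;1−βⱼ) = calS1 c′ χ b j`, for `b` vanishing from `P` on.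
[cite: Zhang2022LandauSiegel, §15 (15.17) p. 85] -/
theorem sum_Icc_Icc_eq_calS1 [NeZero D] (b : ℕ → ℂ)
    (hb : ∀ n : ℕ, Skeleton.bigP D ≤ n → b n = 0) (j : ℕ) :
    ∑ d ∈ Finset.Icc 1 ⌊Skeleton.bigP D⌋₊, ∑ l ∈ Finset.Icc 1 ⌊Skeleton.bigP D⌋₊,
        b (d * l) * χ (l : ZMod D) / ((d : ℂ) * l) *
          (lam1 c' χ d 1 * (d : ℂ) ^ Skeleton.betaJ c' D j *
            calM1 c' χ d l (1 - Skeleton.betaJ c' D j)) =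
      calS1 c' χ b j := by
  rw [calS1]
  exact sum_Icc_Icc_eq_sum_Ico_divisorsAntidiagonal c' χ b hb _ _

/-- **With the whole main term of (15.15) inserted**: `Σ_{d,l≤⌊P⌋} b(dl)χ(l)/(dl)·(λ₁(d)Σ_{j≤3}ℛ₁ⱼd^{βⱼ}
𝓜₁(d,l;1−βⱼ)) = Σ_{j≤3} ℛ₁ⱼ·𝒮₁ⱼ` (any `b` vanishing from `P` on; `ℛ₁ⱼ = calR1`). This is the identity
behind "we obtain `Φ₁(p) = ℛ₁*Dpφ(D)⁻¹Σ_{j≤3}ℛ₁ⱼ𝒮₁ⱼ + o(p)`". [cite: Zhang2022LandauSiegel, §15 (15.17) p. 85] -/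
theorem sum_Icc_Icc_main1515_eq [NeZero D] (b : ℕ → ℂ)
    (hb : ∀ n : ℕ, Skeleton.bigP D ≤ n → b n = 0) :
    ∑ d ∈ Finset.Icc 1 ⌊Skeleton.bigP D⌋₊, ∑ l ∈ Finset.Icc 1 ⌊Skeleton.bigP D⌋₊,
        b (d * l) * χ (l : ZMod D) / ((d : ℂ) * l) *
          (lam1 c' χ d 1 * ∑ j ∈ ({1, 2, 3} : Finset ℕ),
            calR1 c' χ j * (d : ℂ) ^ Skeleton.betaJ c' D j *
              calM1 c' χ d l (1 - Skeleton.betaJ c' D j)) =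
      ∑ j ∈ ({1, 2, 3} : Finset ℕ), calR1 c' χ j * calS1 c' χ b j := by
  have key : ∀ d l : ℕ,
      b (d * l) * χ (l : ZMod D) / ((d : ℂ) * l) *
          (lam1 c' χ d 1 * ∑ j ∈ ({1, 2, 3} : Finset ℕ),
            calR1 c' χ j * (d : ℂ) ^ Skeleton.betaJ c' D j *
              calM1 c' χ d l (1 - Skeleton.betaJ c' D j)) =
        ∑ j ∈ ({1, 2, 3} : Finset ℕ), calR1 c' χ j *
          (b (d * l) * χ (l : ZMod D) / ((d : ℂ) * l) *
            (lam1 c' χ d 1 * (d : ℂ) ^ Skeleton.betaJ c' D j *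
              calM1 c' χ d l (1 - Skeleton.betaJ c' D j))) := by
    intro d l
    rw [Finset.mul_sum, Finset.mul_sum]
    exact Finset.sum_congr rfl fun j _ => by ring
  simp_rw [key]
  have hswap : ∀ d ∈ Finset.Icc 1 ⌊Skeleton.bigP D⌋₊,
      (∑ l ∈ Finset.Icc 1 ⌊Skeleton.bigP D⌋₊, ∑ j ∈ ({1, 2, 3} : Finset ℕ), calR1 c' χ j *
          (b (d * l) * χ (l : ZMod D) / ((d : ℂ) * l) *
            (lam1 c' χ d 1 * (d : ℂ) ^ Skeleton.betaJ c' D j *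
              calM1 c' χ d l (1 - Skeleton.betaJ c' D j)))) =
        ∑ j ∈ ({1, 2, 3} : Finset ℕ), ∑ l ∈ Finset.Icc 1 ⌊Skeleton.bigP D⌋₊, calR1 c' χ j *
          (b (d * l) * χ (l : ZMod D) / ((d : ℂ) * l) *
            (lam1 c' χ d 1 * (d : ℂ) ^ Skeleton.betaJ c' D j *
              calM1 c' χ d l (1 - Skeleton.betaJ c' D j))) :=
    fun d _ => Finset.sum_comm
  rw [Finset.sum_congr rfl hswap, Finset.sum_comm]
  refine Finset.sum_congr rfl fun j _ => ?_
  rw [← sum_Icc_Icc_eq_calS1 c' χ b hb j, Finset.mul_sum]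
  refine Finset.sum_congr rfl fun d _ => ?_
  rw [Finset.mul_sum]

end Literature.NumberTheory.LFunctions.Zhang2022.Typed.Section15B
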